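import Mathlib
import HarnessLib
import Literature.Geometry.DiscreteGeometry.KissingPatterns
import Literature.MathematicalPhysics.StatisticalMechanics.MuGroundStateConfiguration

/-!
# Line `birth` of crux `FreeSplittingCertificates.ShellRigidityHcp`
# (stmt-AtomisticToContinuum-12561): stub `stub_limitShell`

The filter-free ONE-STEP limit lemma of the compactness upgrade.  `Z` (a recentred finite
configuration) and `Y` (the limit set) are `δ`-separated subsets of `ℝ³`, two-way `ε`-matched on
the ball `‖·‖ ≤ ‖y‖ + 2a` (`BallMatch ε (‖y‖ + 2a) 0 Z Y`); the particle `p ∈ Z` is within `ε` of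
`y ∈ Y`; the punctured closed `5a/4`-neighbourhood of `p` in `Z`, recentred at `p`, is a finite
set `T` which is `η`-close to the pattern `P` after a linear isometry `A`
(`ShellCloseTo η T P`), and `Z` has no point at distance in `(5a/4, 4a/3]` from `p` (empty zone).
Then, provided `3ε ≤ δ` and `ε ≤ a/100`, the punctured OPEN `13a/10`-neighbourhood of `y` in `Y`
is in bijection with `P` and `(η + 2ε)`-close to `A(P)`.

Proof idea.  Every `z` in the punctured neighbourhood has (by the matching) a particle
`g z ∈ Z` within `ε`; `g z ≠ p` by separation of `Y`, `dist (g z) p ≤ 13a/10 + 2ε ≤ 4a/3`, so by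
the empty zone `g z - p ∈ T` is a shell point, matched by the `η`-matching `e₀ : T ≃ A(P)` to
some `A c`, `c ∈ P`; this defines the map `z ↦ c`.  It moves `z - y` by at most `2ε + η`
(triangle inequality), is injective by the separation of `Y`, and is surjective because every
shell particle `q` (with `q - p = e₀⁻¹ (A c)`) has a partner `s ∈ Y` within `ε`, which lies in
the punctured neighbourhood (`δ - 2ε > 0` forces `s ≠ y`, and `dist s y ≤ 5a/4 + 2ε < 13a/10`)
and satisfies `g s = q` by the separation of `Z`.  Elementary metric geometry; [folklore].
-/

noncomputable section

namespace Summit.AtomisticToContinuum.Crystallization.Theorems.ShellRigidityHcpBirth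

open Literature.Geometry.DiscreteGeometry Literature.MathematicalPhysics.StatisticalMechanics

/-- The one-step limit lemma with the punctured neighbourhood abstracted as a set `W`
characterised by `hW`, and the `η`-matching `e₀ : T ≃ Q` against an abstract finite set `Q`
with `A(P) ⊆ Q ⊆ A(P)` (membership characterisations `hQ`, `hQ'`). [folklore] -/
private theorem exists_equiv_limitShell_aux {a δ ε η : ℝ}
    {P T Q : Finset (EuclideanSpace ℝ (Fin 3))} {Z Y W : Set (EuclideanSpace ℝ (Fin 3))}
    {y p : EuclideanSpace ℝ (Fin 3)}
    {A : EuclideanSpace ℝ (Fin 3) →ₗᵢ[ℝ] EuclideanSpace ℝ (Fin 3)}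
    (hε : 0 < ε) (h3ε : 3 * ε ≤ δ) (hεa : ε ≤ a / 100)
    (hZ : ∀ u ∈ Z, ∀ v ∈ Z, u ≠ v → δ ≤ dist u v)
    (hY : ∀ u ∈ Y, ∀ v ∈ Y, u ≠ v → δ ≤ dist u v)
    (hBM : BallMatch ε (‖y‖ + 2 * a) 0 Z Y)
    (hy : y ∈ Y) (hp : p ∈ Z) (hpy : dist p y ≤ ε)
    (hT : (↑T : Set (EuclideanSpace ℝ (Fin 3))) =
      (fun u => u - p) '' {u ∈ Z | u ≠ p ∧ dist u p ≤ 5 * a / 4})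
    (e₀ : ↥T ≃ ↥Q) (he₀ : ∀ t : ↥T, dist (t : EuclideanSpace ℝ (Fin 3)) (e₀ t) ≤ η)
    (hQ : ∀ x ∈ Q, ∃ c ∈ P, A c = x) (hQ' : ∀ c ∈ P, A c ∈ Q)
    (hzone : ∀ u ∈ Z, u ≠ p → dist u p ≤ 4 * a / 3 → dist u p ≤ 5 * a / 4)
    (hW : ∀ z, z ∈ W ↔ z ∈ Y ∧ z ≠ y ∧ dist z y < 13 / 10 * a) :
    ∃ e : ↥W ≃ ↥P, ∀ z : ↥W,
      dist ((z : EuclideanSpace ℝ (Fin 3)) - y) (A ((e z : ↥P) : EuclideanSpace ℝ (Fin 3))) ≤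
        η + 2 * ε := by
  -- (g) every point of the punctured neighbourhood has a particle of `Z` within `ε`
  have hgex : ∀ z : ↥W, ∃ q ∈ Z, dist q (z : EuclideanSpace ℝ (Fin 3)) ≤ ε := by
    intro z
    obtain ⟨hzY, -, hzd⟩ := (hW z).1 z.2
    refine hBM.1 _ hzY ?_
    rw [dist_zero_right]
    have h1 : ‖(z : EuclideanSpace ℝ (Fin 3))‖ ≤ ‖y‖ + dist (z : EuclideanSpace ℝ (Fin 3)) y :=
      norm_le_norm_add_const_of_dist_le le_rfl
    linarith
  choose g hgZ hgd using hgex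
  -- the particle is not the centre `p`
  have hgne : ∀ z : ↥W, g z ≠ p := by
    intro z h
    obtain ⟨hzY, hzy, -⟩ := (hW z).1 z.2
    have h1 : δ ≤ dist (z : EuclideanSpace ℝ (Fin 3)) y := hY _ hzY _ hy hzy
    have h2 : dist (z : EuclideanSpace ℝ (Fin 3)) y ≤ dist (g z) z + dist (g z) y :=
      dist_triangle_left _ _ _
    have h3 : dist (g z) (z : EuclideanSpace ℝ (Fin 3)) ≤ ε := hgd z
    rw [h] at h2 h3
    linarith
  -- the particle is a shell point (empty zone)
  have hgp : ∀ z : ↥W, dist (g z) p ≤ 5 * a / 4 := by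
    intro z
    obtain ⟨-, -, hzd⟩ := (hW z).1 z.2
    refine hzone _ (hgZ z) (hgne z) ?_
    have h1 : dist (g z) p ≤ dist (g z) z + dist (z : EuclideanSpace ℝ (Fin 3)) y + dist y p :=
      dist_triangle4 _ _ _ _
    have h2 : dist (g z) (z : EuclideanSpace ℝ (Fin 3)) ≤ ε := hgd z
    rw [dist_comm y p] at h1
    linarith
  have hgT : ∀ z : ↥W, g z - p ∈ T := by
    intro z
    have h1 : g z - p ∈ (↑T : Set (EuclideanSpace ℝ (Fin 3))) := by
      rw [hT]
      exact ⟨g z, ⟨hgZ z, hgne z, hgp z⟩, rfl⟩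
    exact Finset.mem_coe.1 h1
  -- (f) the matched pattern point
  have hfex : ∀ z : ↥W, ∃ c ∈ P, A c = ((e₀ ⟨g z - p, hgT z⟩ : ↥Q) : EuclideanSpace ℝ (Fin 3)) :=
    fun z => hQ _ (e₀ ⟨g z - p, hgT z⟩).2
  choose f hfP hfA using hfex
  let F : ↥W → ↥P := fun z => ⟨f z, hfP z⟩
  -- injectivity (separation of `Y`)
  have hFinj : Function.Injective F := by
    intro z z' h
    have h1 : f z = f z' := congrArg Subtype.val h
    have h2 : A (f z) = A (f z') := by rw [h1]
    rw [hfA, hfA] at h2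
    have h3 : g z - p = g z' - p := congrArg Subtype.val (e₀.injective (Subtype.ext h2))
    have h4 : g z = g z' := sub_left_inj.1 h3
    by_contra hne
    have hne' : (z : EuclideanSpace ℝ (Fin 3)) ≠ z' := fun h' => hne (Subtype.ext h')
    obtain ⟨hzY, -, -⟩ := (hW z).1 z.2
    obtain ⟨hz'Y, -, -⟩ := (hW z').1 z'.2
    have h5 : δ ≤ dist (z : EuclideanSpace ℝ (Fin 3)) z' := hY _ hzY _ hz'Y hne'
    have h6 : dist (z : EuclideanSpace ℝ (Fin 3)) z' ≤ dist (g z) z + dist (g z) z' :=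
      dist_triangle_left _ _ _
    have h7 : dist (g z) (z : EuclideanSpace ℝ (Fin 3)) ≤ ε := hgd z
    have h8 : dist (g z) (z' : EuclideanSpace ℝ (Fin 3)) ≤ ε := by rw [h4]; exact hgd z'
    linarith
  -- surjectivity (every shell particle has a partner in `Y`)
  have hFsurj : Function.Surjective F := by
    intro c
    have hc : A c ∈ Q := hQ' _ c.2
    have htT : ((e₀.symm ⟨A c, hc⟩ : ↥T) : EuclideanSpace ℝ (Fin 3)) ∈
        (↑T : Set (EuclideanSpace ℝ (Fin 3))) := (e₀.symm ⟨A c, hc⟩).2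
    rw [hT] at htT
    obtain ⟨q, ⟨hqZ, hqp, hqd⟩, hqt⟩ := htT
    have hq0 : dist q 0 ≤ ‖y‖ + 2 * a := by
      rw [dist_zero_right]
      have h1 : ‖q‖ ≤ ‖p‖ + 5 * a / 4 := norm_le_norm_add_const_of_dist_le hqd
      have h2 : ‖p‖ ≤ ‖y‖ + ε := norm_le_norm_add_const_of_dist_le hpy
      linarith
    obtain ⟨s, hsY, hqs⟩ := hBM.2 q hqZ hq0
    have hδqp : δ ≤ dist q p := hZ _ hqZ _ hp hqp
    have hsy : s ≠ y := by
      intro hsy'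
      rw [hsy'] at hqs
      have h1 : dist q p ≤ dist q y + dist p y := dist_triangle_right _ _ _
      linarith
    have hsd : dist s y < 13 / 10 * a := by
      have h1 : dist s y ≤ dist s q + dist q p + dist p y := dist_triangle4 _ _ _ _
      rw [dist_comm s q] at h1
      linarith
    let w : ↥W := ⟨s, (hW s).2 ⟨hsY, hsy, hsd⟩⟩
    have hgw : g w = q := by
      by_contra hne
      have h1 : δ ≤ dist (g w) q := hZ _ (hgZ w) _ hqZ hne
      have h2 : dist (g w) q ≤ dist (g w) s + dist q s := dist_triangle_right _ _ _
      have h3 : dist (g w) s ≤ ε := hgd w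
      linarith
    refine ⟨w, Subtype.ext ?_⟩
    show f w = c
    apply A.injective
    rw [hfA]
    have h4 : (⟨g w - p, hgT w⟩ : ↥T) = e₀.symm ⟨A c, hc⟩ := by
      apply Subtype.ext
      show g w - p = _
      rw [hgw]
      exact hqt
    rw [h4, Equiv.apply_symm_apply]
  -- the bijection and the displacement bound
  refine ⟨Equiv.ofBijective F ⟨hFinj, hFsurj⟩, fun z => ?_⟩
  rw [Equiv.ofBijective_apply]
  show dist ((z : EuclideanSpace ℝ (Fin 3)) - y) (A (f z)) ≤ η + 2 * ε
  rw [hfA]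
  have h1 : dist (z : EuclideanSpace ℝ (Fin 3)) (g z) ≤ ε := by rw [dist_comm]; exact hgd z
  have h2 : dist y p ≤ ε := by rw [dist_comm]; exact hpy
  have h3 : dist (g z - p) ((e₀ ⟨g z - p, hgT z⟩ : ↥Q) : EuclideanSpace ℝ (Fin 3)) ≤ η :=
    he₀ ⟨g z - p, hgT z⟩
  calc dist ((z : EuclideanSpace ℝ (Fin 3)) - y)
        ((e₀ ⟨g z - p, hgT z⟩ : ↥Q) : EuclideanSpace ℝ (Fin 3))
      ≤ dist ((z : EuclideanSpace ℝ (Fin 3)) - y) (g z - p) +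
          dist (g z - p) ((e₀ ⟨g z - p, hgT z⟩ : ↥Q) : EuclideanSpace ℝ (Fin 3)) :=
        dist_triangle _ _ _
    _ ≤ (ε + ε) + η := add_le_add (dist_sub_sub_le_of_le h1 h2) h3
    _ = η + 2 * ε := by ring

/-- **stub_limitShell** (one step of the limit, no filters).  `Z` is a recentred configuration and
`Y` the limit set, both `δ`-separated; `Z` and `Y` are two-way `ε`-matched on the ball
`‖·‖ ≤ ‖y‖ + 2a`; `p ∈ Z` is within `ε` of `y ∈ Y`; the punctured closed `5a/4`-neighbourhood of
`p` in `Z`, recentred, is `η`-close to the pattern `P`, and `Z` has no point at distance in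
`(5a/4, 4a/3]` from `p`.  Then (`3ε ≤ δ`, `ε ≤ a/100`) the punctured OPEN `13/10 a`-neighbourhood
of `y` in `Y` is in bijection with `P`, `(η + 2ε)`-close after the same linear isometry: each such
`z` has a unique particle `p_z ∈ Z` within `ε`, `p_z - p` is a shell point (empty zone), matched
to `A c`, `c ∈ P`; injective by separation, surjective because every shell particle has a partner
in `Y`. [folklore] -/
theorem stub_limitShell :
    ∀ (a δ ε η : ℝ) (P : Finset (EuclideanSpace ℝ (Fin 3))) (Z Y : Set (EuclideanSpace ℝ (Fin 3)))
      (y p : EuclideanSpace ℝ (Fin 3)),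
      0 < a → 0 < δ → 0 < ε → 3 * ε ≤ δ → ε ≤ a / 100 →
      (∀ u ∈ Z, ∀ v ∈ Z, u ≠ v → δ ≤ dist u v) →
      (∀ u ∈ Y, ∀ v ∈ Y, u ≠ v → δ ≤ dist u v) →
      BallMatch ε (‖y‖ + 2 * a) 0 Z Y →
      y ∈ Y → p ∈ Z → dist p y ≤ ε →
      (∃ T : Finset (EuclideanSpace ℝ (Fin 3)),
        (↑T : Set (EuclideanSpace ℝ (Fin 3))) =
            (fun u => u - p) '' {u ∈ Z | u ≠ p ∧ dist u p ≤ 5 * a / 4} ∧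
          ShellCloseTo η T P) →
      (∀ u ∈ Z, u ≠ p → dist u p ≤ 4 * a / 3 → dist u p ≤ 5 * a / 4) →
      ∃ A : EuclideanSpace ℝ (Fin 3) →ₗᵢ[ℝ] EuclideanSpace ℝ (Fin 3),
        ∃ e : ↥{z : EuclideanSpace ℝ (Fin 3) | z ∈ Y ∧ z ≠ y ∧ dist z y < 13 / 10 * a} ≃ ↥P,
          ∀ z : ↥{z : EuclideanSpace ℝ (Fin 3) | z ∈ Y ∧ z ≠ y ∧ dist z y < 13 / 10 * a},
            dist ((z : EuclideanSpace ℝ (Fin 3)) - y) (A ((e z : ↥P) : EuclideanSpace ℝ (Fin 3))) ≤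
              η + 2 * ε := by
  intro a δ ε η P Z Y y p _ _ hε h3ε hεa hZ hY hBM hy hp hpy hT hzone
  obtain ⟨T, hT, A, e₀, he₀⟩ := hT
  exact ⟨A, exists_equiv_limitShell_aux
    (W := {z : EuclideanSpace ℝ (Fin 3) | z ∈ Y ∧ z ≠ y ∧ dist z y < 13 / 10 * a})
    hε h3ε hεa hZ hY hBM hy hp hpy hT e₀ he₀ (fun x hx => Finset.mem_image.1 hx)
    (fun c hc => Finset.mem_image_of_mem _ hc) hzone fun _ => Iff.rfl⟩

end Summit.AtomisticToContinuum.Crystallization.Theorems.ShellRigidityHcpBirth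

end
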